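import Literature.Algebra.EuclideanLattices.SmoothingParameterBounds
import Mathlib.Analysis.SpecialFunctions.Gaussian.FourierTransform
import Mathlib.MeasureTheory.Group.FundamentalDomain
import Mathlib.MeasureTheory.Constructions.Polish.Basic
import HarnessLib

/-!
# MR07 Lemma 4.1: a Gaussian of width `s` is `½ ρ_{1/s}(L* ∖ {0})`-close to uniform modulo the lattice

Topic `Algebra/EuclideanLattices` (family `pqc`), sequel of `SmoothingParameterBounds.lean`; serves the
decomposition of Micciancio–Regev 2007, Thm. 5.23
(`Literature.Computability.Cryptography.MicciancioRegev2007_gapCVP'_to_SIS'`): Lemma 4.1 is the first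
property of the sampling procedure of Lemma 5.7 used on p. 29 ("the pairs `(cᵢ, yᵢ)` … satisfy that `cᵢ` is
within distance `ε/2` from the uniform distribution"), and it is the lemma that gives the smoothing
parameter its name. Everything here is PROVED; theorems only, no new definitions: the continuous Gaussian
`D_{s,c}` enters through its density `s⁻ⁿ ρ_s(x - c)` w.r.t. the canonical volume of the inner product
space, "mod `P(B)`" through measurable `L`-periodic events and the fundamental parallelepiped
`ZSpan.fundamentalDomain` of a `ℤ`-basis of `L` (Mathlib's `ZLattice.isAddFundamentalDomain`), and the
statistical distance is unfolded on events.

## Results (`L` a full-rank lattice in dimension `n`, `0 < s`, `c ∈ V`)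

* `abs_tsum_gaussianFunction_add_sub_div_sub_inv_covolume_le` — **pointwise** (MR07 p. 12, footnote 12):
  `|s⁻ⁿ ∑_{y ∈ L} ρ_s(y + x - c) - 1/vol(L)| ≤ ρ_{1/s}(L* ∖ {0})/vol(L)` for all `x`
  (shifted Poisson identity of `GaussianLatticeSums.lean`); `…_of_smoothingParameter_le`: `≤ ε/vol(L)`
  for `s ≥ η_ε(L)`.
* `setIntegral_fundamentalDomain_abs_sub_inv_covolume_le` — **`L¹` form**:
  `∫_{P(b)} |Y - 1/vol| ≤ ρ_{1/s}(L* ∖ {0})` with `Y(x) = s⁻ⁿ ∑_{y ∈ L} ρ_s(y + x - c)`.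
* `lintegral_mul_ofReal_gaussianFunction_eq_setLIntegral_tsum` — **periodization**: for measurable
  `L`-periodic `g ≥ 0`, `∫ g ρ_s(· - c) = ∫_{P(b)} g · ∑_{y ∈ L} ρ_s(y + · - c)` (the law of
  `D_{s,c} mod P(b)` has density `Y` on `P(b)`).
* `integral_gaussianFunction_sub`, `integrable_gaussianFunction_sub` — `∫ ρ_s(x - c) dx = sⁿ` (MR07 §2,
  p. 8) and integrability, from Mathlib's `GaussianFourier.integral_rexp_neg_mul_sq_norm`.
* `MicciancioRegev2007.abs_gaussianMeasure_sub_uniform_le` — **MR07 Lemma 4.1**: for every measurable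
  `L`-periodic event `A`, `|D_{s,c}(A) - vol(A ∩ P(b))/vol(P(b))| ≤ ½ ρ_{1/s}(L* ∖ {0})`;
  `…_le_half_of_smoothingParameter_le`: `≤ ε/2` for `s ≥ η_ε(L)` ("in particular").

## References

* D. Micciancio, O. Regev, *Worst-case to average-case reductions based on Gaussian measures*,
  SIAM J. Comput. 37 (2007) 267–302; Lemma 4.1 and its proof, footnote 12, §2 eq. before (6)
  (pp. 8, 10, 12 of the authors' version, `lit read doi:10.1137/S0097539705447360`).
-/

noncomputable section

open MeasureTheory Module Metric Filter Set
open scoped Real ENNReal InnerProductSpace Topology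

namespace Literature.Algebra.EuclideanLattices

variable {V : Type*} [NormedAddCommGroup V] [InnerProductSpace ℝ V] [FiniteDimensional ℝ V]
  [MeasurableSpace V] [BorelSpace V]
variable (L : Submodule ℤ V) [DiscreteTopology L] [IsZLattice ℝ L]

/-- **The periodized Gaussian is pointwise close to the uniform density** (Micciancio–Regev 2007,
proof of Lemma 4.1, p. 12: "`Y(x) = det(L*) (1 + ∑_{w ∈ L* ∖ {0}} e^{2πi⟨x - c, w⟩} ρ_{1/s}(w))`", whence
`|Y(x) - det(L*)| ≤ det(L*) ρ_{1/s}(L* ∖ {0})`; this is the "stronger property" of MR07 footnote 12):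
for a full-rank lattice `L`, `s > 0` and all `c, x`,
`|s⁻ⁿ ∑_{y ∈ L} ρ_s(y + x - c) - 1/vol(L)| ≤ ρ_{1/s}(L* ∖ {0}) / vol(L)`.
[cite: MicciancioRegev2007, Lemma 4.1 (proof, p. 12)] -/
theorem abs_tsum_gaussianFunction_add_sub_div_sub_inv_covolume_le {s : ℝ} (hs : 0 < s) (c x : V) :
    |(∑' y : L, gaussianFunction s ((y : V) + x - c)) / s ^ finrank ℝ V - (ZLattice.covolume L)⁻¹| ≤
      (ZLattice.covolume L)⁻¹ * (gaussianMass s⁻¹ 0 ((dualLattice L : Set V) \ {0})).toReal := by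
  classical
  have hcov : 0 < ZLattice.covolume L := ZLattice.covolume_pos L volume
  have hsum : ∑' y : L, gaussianFunction s ((y : V) + x - c) =
      ∑' y : L, gaussianFunction s ((y : V) - (c - x)) :=
    tsum_congr fun y ↦ by rw [show (y : V) + x - c = (y : V) - (c - x) by abel]
  rw [hsum, tsum_gaussianFunction_sub_eq L hs (c - x)]
  set P : ℝ := ∑' w : dualLattice L, gaussianFunction s⁻¹ (w : V) * Real.cos (2 * π * ⟪c - x, (w : V)⟫_ℝ)
    with hP
  have hsn : s ^ finrank ℝ V ≠ 0 := pow_ne_zero _ hs.ne'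
  have hrew : (ZLattice.covolume L)⁻¹ * s ^ finrank ℝ V * P / s ^ finrank ℝ V - (ZLattice.covolume L)⁻¹ =
      (ZLattice.covolume L)⁻¹ * (P - 1) := by
    field_simp
  rw [hrew, abs_mul, abs_of_pos (inv_pos.2 hcov)]
  refine mul_le_mul_of_nonneg_left ?_ (inv_pos.2 hcov).le
  -- `|P - 1| ≤ ρ_{1/s}(L* ∖ {0})`: split off the term `w = 0`, which is `1`
  have hS : Summable fun w : dualLattice L ↦ gaussianFunction s⁻¹ (w : V) * Real.cos (2 * π * ⟪c - x, (w : V)⟫_ℝ) :=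
    summable_gaussianFunction_mul_cos _ (inv_ne_zero hs.ne') (c - x)
  have hsplit := hS.tsum_eq_add_tsum_ite (0 : dualLattice L)
  simp only [ZeroMemClass.coe_zero, gaussianFunction_zero, inner_zero_right, mul_zero, Real.cos_zero,
    mul_one] at hsplit
  rw [hP, hsplit, add_sub_cancel_left]
  set g : dualLattice L → ℝ := fun w ↦ if w = 0 then 0 else gaussianFunction s⁻¹ (w : V) with hg
  have hnn : ∀ w, 0 ≤ g w := fun w ↦ by
    simp only [hg]
    split_ifs
    · exact le_rfl
    · exact (gaussianFunction_pos _ _).le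
  have hρS : Summable fun w : dualLattice L ↦ gaussianFunction s⁻¹ (w : V) :=
    (summable_gaussianFunction_sub (dualLattice L) (inv_ne_zero hs.ne') (0 : V)).congr fun w ↦ by rw [sub_zero]
  have hgS : Summable g := by
    refine Summable.of_nonneg_of_le hnn (fun w ↦ ?_) hρS
    simp only [hg]
    split_ifs
    · exact (gaussianFunction_pos _ _).le
    · exact le_rfl
  have hR : |∑' w : dualLattice L,
      (if w = 0 then 0 else gaussianFunction s⁻¹ (w : V) * Real.cos (2 * π * ⟪c - x, (w : V)⟫_ℝ))| ≤
      ∑' w, g w := by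
    rw [← Real.norm_eq_abs]
    apply tsum_of_norm_bounded hgS.hasSum
    intro w
    simp only [hg]
    split_ifs
    · simp
    · rw [Real.norm_eq_abs, abs_mul, abs_of_pos (gaussianFunction_pos _ _)]
      exact mul_le_of_le_one_right (gaussianFunction_pos _ _).le (Real.abs_cos_le_one _)
  have hT : ∑' w, g w = (gaussianMass s⁻¹ 0 ((dualLattice L : Set V) \ {0})).toReal := by
    rw [gaussianMass_dual_sdiff_zero_eq_ofReal_tsum_ite L (inv_ne_zero hs.ne'),
      ENNReal.toReal_ofReal (tsum_nonneg hnn)]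
  exact hR.trans hT.le

/-- The same bound under the smoothing hypothesis: for `0 < ε`, `0 < s` with `η_ε(L) ≤ s`,
`|s⁻ⁿ ∑_{y ∈ L} ρ_s(y + x - c) - 1/vol(L)| ≤ ε / vol(L)` for all `c, x` (Micciancio–Regev 2007,
Lemma 4.1 "in particular" with footnote 12). [cite: MicciancioRegev2007, Lemma 4.1 (p. 12, footnote 12)] -/
theorem abs_tsum_gaussianFunction_add_sub_div_sub_inv_covolume_le_of_smoothingParameter_le {ε s : ℝ}
    (hε : 0 < ε) (hs : 0 < s) (hηs : smoothingParameter L ε ≤ s) (c x : V) :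
    |(∑' y : L, gaussianFunction s ((y : V) + x - c)) / s ^ finrank ℝ V - (ZLattice.covolume L)⁻¹| ≤
      (ZLattice.covolume L)⁻¹ * ε := by
  have hcov : 0 < ZLattice.covolume L := ZLattice.covolume_pos L volume
  refine (abs_tsum_gaussianFunction_add_sub_div_sub_inv_covolume_le L hs c x).trans ?_
  refine mul_le_mul_of_nonneg_left ?_ (inv_pos.2 hcov).le
  have h1 : gaussianMass s⁻¹ 0 ((dualLattice L : Set V) \ {0}) ≤ ENNReal.ofReal ε := by
    rw [← one_div]
    exact gaussianMass_dual_le_of_smoothingParameter_le L hε hηs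
  exact ENNReal.toReal_le_of_le_ofReal hε.le h1

/-- **Micciancio–Regev 2007, Lemma 4.1, `L¹` form over a fundamental parallelepiped** (p. 12:
"`∆(Y, U) = ½ ∫_{P(B)} |Y(x) - U(x)| dx ≤ ½ vol(P(B)) · max_x |Y(x) - det(L*)| ≤ ½ ρ_{1/s}(L* ∖ {0})`"):
for every `ℤ`-basis `b` of the full-rank lattice `L`, `s > 0` and `c`,
`∫_{P(b)} |s⁻ⁿ ∑_{y ∈ L} ρ_s(y + x - c) - 1/vol(L)| dx ≤ ρ_{1/s}(L* ∖ {0})`, where `P(b)` is the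
fundamental parallelepiped `ZSpan.fundamentalDomain` of `b` (the factor `½` sits in MR07's definition of
`∆`). [cite: MicciancioRegev2007, Lemma 4.1 (proof, p. 12)] -/
theorem setIntegral_fundamentalDomain_abs_sub_inv_covolume_le {ι : Type*} [Fintype ι] (b : Basis ι ℤ L)
    {s : ℝ} (hs : 0 < s) (c : V) :
    ∫ x in ZSpan.fundamentalDomain (b.ofZLatticeBasis ℝ),
        |(∑' y : L, gaussianFunction s ((y : V) + x - c)) / s ^ finrank ℝ V - (ZLattice.covolume L)⁻¹| ≤
      (gaussianMass s⁻¹ 0 ((dualLattice L : Set V) \ {0})).toReal := by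
  set F : Set V := ZSpan.fundamentalDomain (b.ofZLatticeBasis ℝ) with hF
  have fund : IsAddFundamentalDomain L F volume := ZLattice.isAddFundamentalDomain b volume
  have hcovF : ZLattice.covolume L = volume.real F := ZLattice.covolume_eq_measure_fundamentalDomain L volume fund
  have hcov : 0 < ZLattice.covolume L := ZLattice.covolume_pos L volume
  have hFfin : volume F < ∞ := (ZSpan.fundamentalDomain_isBounded (b.ofZLatticeBasis ℝ)).measure_lt_top
  set C : ℝ := (ZLattice.covolume L)⁻¹ * (gaussianMass s⁻¹ 0 ((dualLattice L : Set V) \ {0})).toReal with hC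
  have hbound : ∀ x ∈ F,
      ‖|(∑' y : L, gaussianFunction s ((y : V) + x - c)) / s ^ finrank ℝ V - (ZLattice.covolume L)⁻¹|‖ ≤ C :=
    fun x _ ↦ by
      rw [Real.norm_eq_abs, abs_abs]
      exact abs_tsum_gaussianFunction_add_sub_div_sub_inv_covolume_le L hs c x
  have h := norm_setIntegral_le_of_norm_le_const hFfin hbound
  have h2 : ∫ x in F, |(∑' y : L, gaussianFunction s ((y : V) + x - c)) / s ^ finrank ℝ V -
        (ZLattice.covolume L)⁻¹| ≤ C * volume.real F := (Real.le_norm_self _).trans h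
  have h3 : C * volume.real F = (gaussianMass s⁻¹ 0 ((dualLattice L : Set V) \ {0})).toReal := by
    rw [← hcovF, hC, mul_right_comm, inv_mul_cancel₀ hcov.ne', one_mul]
  exact h2.trans h3.le

omit [InnerProductSpace ℝ V] [FiniteDimensional ℝ V] in
/-- Measurability of the translated Gaussian weight `x ↦ ρ_s(y + x - c)` (continuity). [folklore] -/
theorem measurable_ofReal_gaussianFunction_add_sub (s : ℝ) (y c : V) :
    Measurable fun x : V ↦ ENNReal.ofReal (gaussianFunction s (y + x - c)) := by
  refine ENNReal.measurable_ofReal.comp (Continuous.measurable ?_)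
  unfold gaussianFunction
  fun_prop

/-- **Periodization: the law of `D_{s,c} mod L` has density `Y` on a fundamental parallelepiped**
(Micciancio–Regev 2007, proof of Lemma 4.1, p. 12: "Let `Y` be the density function of the
distribution over `P(B)` defined by `D_{s,c} mod P(B)`: `Y(x) = s⁻ⁿ ∑_{y ∈ L(B)} ρ_{s,c}(x + y)`"): for
every measurable `L`-periodic `g : V → [0, ∞]`,
`∫ g(x) ρ_s(x - c) dx = ∫_{P(b)} g(x) (∑_{y ∈ L} ρ_s(y + x - c)) dx` (unnormalised; divide by `sⁿ`, the
total mass `∫ ρ_{s,c} = sⁿ`, to read it for the probability density `s⁻ⁿ ρ_{s,c}`).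
[cite: MicciancioRegev2007, Lemma 4.1 (proof, p. 12)] -/
theorem lintegral_mul_ofReal_gaussianFunction_eq_setLIntegral_tsum {ι : Type*} [Fintype ι]
    (b : Basis ι ℤ L) (s : ℝ) (c : V) {g : V → ℝ≥0∞} (hg : Measurable g)
    (hper : ∀ (y : L) (x : V), g ((y : V) + x) = g x) :
    ∫⁻ x, g x * ENNReal.ofReal (gaussianFunction s (x - c)) =
      ∫⁻ x in ZSpan.fundamentalDomain (b.ofZLatticeBasis ℝ),
        g x * ∑' y : L, ENNReal.ofReal (gaussianFunction s ((y : V) + x - c)) := by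
  set F : Set V := ZSpan.fundamentalDomain (b.ofZLatticeBasis ℝ) with hF
  have fund : IsAddFundamentalDomain L F volume := ZLattice.isAddFundamentalDomain b volume
  have : MeasurableVAdd L V := (inferInstance : MeasurableVAdd L.toAddSubgroup V)
  have : VAddInvariantMeasure L V volume := (inferInstance : VAddInvariantMeasure L.toAddSubgroup V volume)
  rw [fund.lintegral_eq_tsum'' (fun x ↦ g x * ENNReal.ofReal (gaussianFunction s (x - c)))]
  have hv : ∀ (y : L) (x : V), y +ᵥ x = (y : V) + x := fun y x ↦ rfl
  simp_rw [hv, hper]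
  have key := lintegral_tsum (μ := volume.restrict F)
    (f := fun (y : L) (x : V) ↦ g x * ENNReal.ofReal (gaussianFunction s ((y : V) + x - c)))
    (fun y ↦ (hg.mul (measurable_ofReal_gaussianFunction_add_sub s (y : V) c)).aemeasurable)
  rw [← key]
  refine lintegral_congr fun x ↦ ?_
  rw [ENNReal.tsum_mul_left]

/-- **Total mass of the continuous Gaussian** (Micciancio–Regev 2007, §2, p. 8:
"`∫_{x ∈ ℝⁿ} ρ_{s,c}(x) dx = sⁿ`"): `∫ ρ_s(x - c) dx = sⁿ` for `s > 0`, w.r.t. the canonical volume of the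
inner product space. [cite: MicciancioRegev2007, §2 (p. 8)] -/
theorem integral_gaussianFunction_sub {s : ℝ} (hs : 0 < s) (c : V) :
    ∫ x, gaussianFunction s (x - c) = s ^ finrank ℝ V := by
  rw [integral_sub_right_eq_self (fun x : V ↦ gaussianFunction s x) c]
  have hb : 0 < π / s ^ 2 := by positivity
  have h := GaussianFourier.integral_rexp_neg_mul_sq_norm (V := V) hb
  have hfun : (fun x : V ↦ gaussianFunction s x) = fun x : V ↦ Real.exp (-(π / s ^ 2) * ‖x‖ ^ 2) := by
    funext x
    rw [gaussianFunction]
    congr 1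
    ring
  rw [hfun, h]
  have hπs : π / (π / s ^ 2) = s ^ 2 := by field_simp
  rw [hπs, show (s ^ 2 : ℝ) = s ^ (2 : ℝ) by norm_cast, ← Real.rpow_mul hs.le,
    show (2 : ℝ) * ((finrank ℝ V : ℝ) / 2) = (finrank ℝ V : ℝ) by ring, Real.rpow_natCast]

/-- The Gaussian weight `x ↦ ρ_s(x - c)` is integrable on `V` (`0 < s`). [cite: MicciancioRegev2007, §2 (p. 8)] -/
theorem integrable_gaussianFunction_sub {s : ℝ} (hs : 0 < s) (c : V) :
    Integrable (fun x : V ↦ gaussianFunction s (x - c)) := by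
  by_contra h
  have h0 := integral_undef h
  rw [integral_gaussianFunction_sub hs c] at h0
  exact pow_ne_zero _ hs.ne' h0

omit [MeasurableSpace V] [BorelSpace V] [IsZLattice ℝ L] in
/-- Summability of the periodization `∑_{y ∈ L} ρ_s(y + x - c)`. [cite: MicciancioRegev2007, §2] -/
theorem summable_gaussianFunction_coe_add_sub {s : ℝ} (hs : s ≠ 0) (c x : V) :
    Summable fun y : L ↦ gaussianFunction s ((y : V) + x - c) :=
  (summable_gaussianFunction_sub L hs (c - x)).congr fun y ↦ by
    rw [show (y : V) - (c - x) = (y : V) + x - c by abel]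

/-- Measurability of the periodization `x ↦ ∑_{y ∈ L} ρ_s(y + x - c)` (a countable sum of continuous
functions, `Measurable.tsum`). [folklore] -/
theorem measurable_tsum_gaussianFunction_coe_add_sub (s : ℝ) (c : V) :
    Measurable fun x : V ↦ ∑' y : L, gaussianFunction s ((y : V) + x - c) := by
  refine Measurable.tsum fun y ↦ Continuous.measurable ?_
  unfold gaussianFunction
  fun_prop

/-- **Micciancio–Regev 2007, Lemma 4.1** (p. 12): *for any `s > 0`, `c` and lattice `L = L(B)`, the
statistical distance between `D_{s,c} mod P(B)` and the uniform distribution over `P(B)` is at most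
`½ ρ_{1/s}(L* ∖ {0})`; in particular it is at most `ε/2` whenever `s ≥ η_ε(L)`.* Here `D_{s,c}` is
the probability measure with density `s⁻ⁿ ρ_s(x - c)`, `P(B)` is the fundamental parallelepiped
`ZSpan.fundamentalDomain` of a `ℤ`-basis `b` of `L`, and the statistical distance is unfolded on events:
for every measurable `L`-periodic set `A` (the preimage of an event of `P(B)` under reduction mod `L`),
`|D_{s,c}(A) - vol(A ∩ P(B))/vol(P(B))| ≤ ½ ρ_{1/s}(L* ∖ {0})`. Proof as printed: the law of
`D_{s,c} mod P(B)` has density `Y(x) = s⁻ⁿ ∑_{y ∈ L} ρ_{s,c}(x + y)` on `P(B)`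
(`lintegral_mul_ofReal_gaussianFunction_eq_setLIntegral_tsum`), `|Y - 1/vol(P(B))| ≤ ρ_{1/s}(L* ∖ {0})/vol`
pointwise by Poisson summation, and `|P(A) - U(A)| ≤ ½ ∫_{P(B)} |Y - U|` since `∫_{P(B)} (Y - U) = 0`.
[cite: MicciancioRegev2007, Lemma 4.1] -/
theorem MicciancioRegev2007.abs_gaussianMeasure_sub_uniform_le {ι : Type*} [Fintype ι] (b : Basis ι ℤ L)
    {s : ℝ} (hs : 0 < s) (c : V) {A : Set V} (hA : MeasurableSet A)
    (hper : ∀ (y : L) (x : V), (y : V) + x ∈ A ↔ x ∈ A) :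
    |(∫ x in A, gaussianFunction s (x - c)) / s ^ finrank ℝ V -
        volume.real (A ∩ ZSpan.fundamentalDomain (b.ofZLatticeBasis ℝ)) / ZLattice.covolume L| ≤
      (gaussianMass s⁻¹ 0 ((dualLattice L : Set V) \ {0})).toReal / 2 := by
  set n : ℕ := finrank ℝ V with hn
  set F : Set V := ZSpan.fundamentalDomain (b.ofZLatticeBasis ℝ) with hF
  have fund : IsAddFundamentalDomain L F volume := ZLattice.isAddFundamentalDomain b volume
  have hcovF : ZLattice.covolume L = volume.real F := ZLattice.covolume_eq_measure_fundamentalDomain L volume fund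
  have hcov : 0 < ZLattice.covolume L := ZLattice.covolume_pos L volume
  have hFfin : volume F < ∞ := (ZSpan.fundamentalDomain_isBounded (b.ofZLatticeBasis ℝ)).measure_lt_top
  have hsn : 0 < s ^ n := pow_pos hs n
  set ρ' : ℝ := (gaussianMass s⁻¹ 0 ((dualLattice L : Set V) \ {0})).toReal with hρ'
  have hρ'0 : 0 ≤ ρ' := ENNReal.toReal_nonneg
  set u : ℝ := (ZLattice.covolume L)⁻¹ with hu
  have hu0 : 0 < u := inv_pos.2 hcov
  -- the periodization `S` and the density `Y = S / sⁿ`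
  set S : V → ℝ := fun x ↦ ∑' y : L, gaussianFunction s ((y : V) + x - c) with hS
  set Y : V → ℝ := fun x ↦ S x / s ^ n with hY
  have hS0 : ∀ x, 0 ≤ S x := fun x ↦ tsum_nonneg fun y ↦ (gaussianFunction_pos _ _).le
  have hSm : Measurable S := measurable_tsum_gaussianFunction_coe_add_sub L s c
  have hYm : Measurable Y := hSm.div_const _
  have hYbd : ∀ x, |Y x - u| ≤ u * ρ' := fun x ↦
    abs_tsum_gaussianFunction_add_sub_div_sub_inv_covolume_le L hs c x
  have hYbd' : ∀ x, ‖Y x‖ ≤ u + u * ρ' := fun x ↦ by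
    rw [Real.norm_eq_abs]
    have := hYbd x
    have h1 : |Y x| ≤ |Y x - u| + |u| := by
      have := abs_add_le (Y x - u) u
      rwa [sub_add_cancel] at this
    rw [abs_of_pos hu0] at h1
    linarith
  have hSbd : ∀ x, ‖S x‖ ≤ s ^ n * (u + u * ρ') := fun x ↦ by
    have hSY : S x = s ^ n * Y x := by rw [hY]; field_simp
    rw [hSY, norm_mul, Real.norm_eq_abs, abs_of_pos hsn]
    exact mul_le_mul_of_nonneg_left (hYbd' x) hsn.le
  -- integrability on subsets of `F`
  have hintS : ∀ {B : Set V}, B ⊆ F → IntegrableOn S B volume := fun {B} hB ↦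
    Measure.integrableOn_of_bounded (M := s ^ n * (u + u * ρ'))
      (lt_of_le_of_lt (measure_mono hB) hFfin).ne hSm.aestronglyMeasurable (ae_of_all _ hSbd)
  have hintY : ∀ {B : Set V}, B ⊆ F → IntegrableOn Y B volume := fun {B} hB ↦
    Measure.integrableOn_of_bounded (M := u + u * ρ')
      (lt_of_le_of_lt (measure_mono hB) hFfin).ne hYm.aestronglyMeasurable (ae_of_all _ hYbd')
  have hintYu : ∀ {B : Set V}, B ⊆ F → IntegrableOn (fun x ↦ Y x - u) B volume := fun {B} hB ↦
    (hintY hB).sub (integrableOn_const (C := u) (lt_of_le_of_lt (measure_mono hB) hFfin).ne)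
  -- Step 1: `∫_B ρ_s(x - c) dx = ∫_{B ∩ F} S` for every measurable `L`-periodic `B`
  have hstep1 : ∀ {B : Set V}, MeasurableSet B → (∀ (y : L) (x : V), (y : V) + x ∈ B ↔ x ∈ B) →
      ∫ x in B, gaussianFunction s (x - c) = ∫ x in B ∩ F, S x := by
    intro B hB hBper
    have hg : Measurable (B.indicator (1 : V → ℝ≥0∞)) := measurable_one.indicator hB
    have hgper : ∀ (y : L) (x : V), B.indicator (1 : V → ℝ≥0∞) ((y : V) + x) = B.indicator 1 x := by
      intro y x
      by_cases hx : x ∈ B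
      · rw [Set.indicator_of_mem hx, Set.indicator_of_mem ((hBper y x).2 hx)]
        rfl
      · rw [Set.indicator_of_notMem hx, Set.indicator_of_notMem (fun h ↦ hx ((hBper y x).1 h))]
    have key := lintegral_mul_ofReal_gaussianFunction_eq_setLIntegral_tsum L b s c hg hgper
    have hL : ∫⁻ x, B.indicator (1 : V → ℝ≥0∞) x * ENNReal.ofReal (gaussianFunction s (x - c)) =
        ∫⁻ x in B, ENNReal.ofReal (gaussianFunction s (x - c)) := by
      rw [← lintegral_indicator hB]
      refine lintegral_congr fun x ↦ ?_
      by_cases hx : x ∈ B <;> simp [hx]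
    have hR : ∫⁻ x in F, B.indicator (1 : V → ℝ≥0∞) x *
          ∑' y : L, ENNReal.ofReal (gaussianFunction s ((y : V) + x - c)) =
        ∫⁻ x in B ∩ F, ENNReal.ofReal (S x) := by
      rw [← Measure.restrict_restrict hB, ← lintegral_indicator hB]
      refine lintegral_congr fun x ↦ ?_
      by_cases hx : x ∈ B
      · simp only [hx, Set.indicator_of_mem, Pi.one_apply, one_mul]
        exact (ENNReal.ofReal_tsum_of_nonneg (fun y ↦ (gaussianFunction_pos _ _).le)
          (summable_gaussianFunction_coe_add_sub L hs.ne' c x)).symm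
      · simp [hx]
    rw [hL, hR] at key
    have hintL : IntegrableOn (fun x ↦ gaussianFunction s (x - c)) B volume :=
      (integrable_gaussianFunction_sub hs c).integrableOn
    rw [← ofReal_integral_eq_lintegral_ofReal hintL (ae_of_all _ fun x ↦ (gaussianFunction_pos _ _).le),
      ← ofReal_integral_eq_lintegral_ofReal (hintS Set.inter_subset_right) (ae_of_all _ fun x ↦ hS0 x)] at key
    exact (ENNReal.ofReal_eq_ofReal_iff (integral_nonneg fun x ↦ (gaussianFunction_pos _ _).le)
      (integral_nonneg fun x ↦ hS0 x)).1 key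
  -- Step 2: total mass, `∫_F Y = 1`
  have hmassS : ∫ x in F, S x = s ^ n := by
    have h := hstep1 MeasurableSet.univ (fun y x ↦ by simp)
    rw [setIntegral_univ, Set.univ_inter, integral_gaussianFunction_sub hs c] at h
    exact h.symm
  have hmassY : ∫ x in F, Y x = 1 := by
    change ∫ x in F, S x / s ^ n = 1
    rw [integral_div, hmassS, div_self hsn.ne']
  -- Step 3: `∫_F (Y - u) = 0`
  have hzero : ∫ x in F, (Y x - u) = 0 := by
    rw [integral_sub (hintY subset_rfl) (integrableOn_const (C := u) hFfin.ne), hmassY, setIntegral_const,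
      smul_eq_mul, ← hcovF, hu, mul_inv_cancel₀ hcov.ne', sub_self]
  -- Step 4: `2 |∫_{F ∩ A} (Y - u)| ≤ ∫_F |Y - u| ≤ ρ'`
  have hsplit := integral_inter_add_sdiff (μ := volume) hA (hintYu subset_rfl)
  rw [hzero] at hsplit
  have hsplit_abs := integral_inter_add_sdiff (μ := volume) (f := fun x ↦ |Y x - u|) hA (hintYu subset_rfl).abs
  have hL1 : ∫ x in F, |Y x - u| ≤ ρ' := setIntegral_fundamentalDomain_abs_sub_inv_covolume_le L b hs c
  have h1 : |∫ x in F ∩ A, (Y x - u)| ≤ ∫ x in F ∩ A, |Y x - u| := abs_integral_le_integral_abs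
  have h2 : |∫ x in F \ A, (Y x - u)| ≤ ∫ x in F \ A, |Y x - u| := abs_integral_le_integral_abs
  have h3 : |∫ x in F ∩ A, (Y x - u)| = |∫ x in F \ A, (Y x - u)| := by
    rw [show ∫ x in F ∩ A, (Y x - u) = -∫ x in F \ A, (Y x - u) by linarith, abs_neg]
  have hmain : |∫ x in F ∩ A, (Y x - u)| ≤ ρ' / 2 := by linarith
  -- Step 5: identify the left-hand side
  have hYint : ∫ x in F ∩ A, (Y x - u) = (∫ x in A, gaussianFunction s (x - c)) / s ^ n -
      volume.real (A ∩ F) / ZLattice.covolume L := by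
    rw [integral_sub (hintY Set.inter_subset_left) (integrableOn_const (C := u)
        (lt_of_le_of_lt (measure_mono Set.inter_subset_left) hFfin).ne),
      setIntegral_const, smul_eq_mul, hstep1 hA hper, Set.inter_comm A F]
    change (∫ x in F ∩ A, S x / s ^ n) - _ = _
    rw [integral_div, hu]
    ring
  rw [← hYint]
  exact hmain

/-- **Micciancio–Regev 2007, Lemma 4.1, "in particular"**: for `0 < ε`, `0 < s` with `η_ε(L) ≤ s`, every
`ℤ`-basis `b` of `L`, every centre `c` and every measurable `L`-periodic event `A`,
`|D_{s,c}(A) - vol(A ∩ P(b))/vol(P(b))| ≤ ε/2`. [cite: MicciancioRegev2007, Lemma 4.1] -/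
theorem MicciancioRegev2007.abs_gaussianMeasure_sub_uniform_le_half_of_smoothingParameter_le {ι : Type*}
    [Fintype ι] (b : Basis ι ℤ L) {ε s : ℝ} (hε : 0 < ε) (hs : 0 < s) (hηs : smoothingParameter L ε ≤ s)
    (c : V) {A : Set V} (hA : MeasurableSet A) (hper : ∀ (y : L) (x : V), (y : V) + x ∈ A ↔ x ∈ A) :
    |(∫ x in A, gaussianFunction s (x - c)) / s ^ finrank ℝ V -
        volume.real (A ∩ ZSpan.fundamentalDomain (b.ofZLatticeBasis ℝ)) / ZLattice.covolume L| ≤ ε / 2 := by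
  refine (MicciancioRegev2007.abs_gaussianMeasure_sub_uniform_le L b hs c hA hper).trans ?_
  have h1 : gaussianMass s⁻¹ 0 ((dualLattice L : Set V) \ {0}) ≤ ENNReal.ofReal ε := by
    rw [← one_div]
    exact gaussianMass_dual_le_of_smoothingParameter_le L hε hηs
  have h2 := ENNReal.toReal_le_of_le_ofReal hε.le h1
  linarith

end Literature.Algebra.EuclideanLattices

end
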